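import Summits.Schanuel.Schanuel.Theorems.RootDecomp1KMeasuredWallCell06

/-!
# RootDecomp1KMeasuredWallCell — lens 1, generation 38 «MEASURED WALL CELL of 33364» (the mixed wall (1, ℓ₂, ℓ₃, ρ) for every ρ in the tree class LogHyperLiouville) — continuation (RootDecomp1KMeasuredWallCell07): §6 the member `zM = (1, ℓ₂, ℓ₃, ℓ_T)` / `zMpi` with hypothesis-free certificates (`linearIndependent_zM`, `linLiouville_zM`, `not_hyperLinLiouville_zM`, π-twins), `sb_zM (hNW)`, `sb_zMpi`, `zM_in_scope_33364`, `finiteOrderLiouvilleSchanuel_at_zM(pi)`, and the separation (`ellT_ne_liouvilleNumber`, `range_zM_ne_range_fin_three`, `zM_outside_liouvilleBlockCells`, `zM_outside_fin_three_cells`, π-twins)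

(lens-1 g38 `RootDecomp1KMeasuredWallCell.lean` [HOME/decomp-schanuel-lens-1/g38/RootDecomp1KMeasuredWallCell.lean sha256 168ec8e8…3303, 1895 l + MWprobe 0edab326… + MWctrl b192be9d… + NODE-g38.md 03a7462f…; NOTE/CLAIM L1764, ACK + CHECKLIST K-g38 L1782, NODE L1785 / REQUEST L1786 / RESULT L1787; writer re-check L1790]; port by census-1 gen 16 in seven parts
`RootDecomp1KMeasuredWallCell01`–`07` — see the PORT NOTE of part 01; `--supports stmt-Schanuel-33364`; rung 0.)
-/

noncomputable section

open Complex IntermediateField Polynomial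
open Summit.Schanuel.Schanuel.Theorems.RootDecomp1KHyper
open Summit.Schanuel.Schanuel.Theorems.RootDecomp1KHyper.HyperCell
open Summit.Schanuel.Schanuel.Theorems.RootDecomp1KGeneric
open Summit.Schanuel.Schanuel.Theorems.RootDecomp1KRelLiouvilleCell
open Summit.Schanuel.Schanuel.Theorems.RootDecomp1KLogLogCell (LogLogLiouville logLogLiouville_of_logHyperLiouville)
open Summit.Schanuel.Schanuel.Theorems.RootDecomp1KTwoBaseCell

namespace Summit.Schanuel.Schanuel.Theorems.RootDecomp1KMeasuredWallCell

open LiouvilleNumber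
open scoped Nat

section Member
open LiouvilleNumber
open scoped Nat

/-! ### The member and its certificates -/

/-- The measured wall member `z_M := (1, ℓ₂, ℓ₃, ℓ_T)`. -/
noncomputable def zM : Fin 4 → ℂ :=
  ![(1 : ℂ), ((liouvilleNumber 2 : ℝ) : ℂ), ((liouvilleNumber 3 : ℝ) : ℂ), ((ellT : ℝ) : ℂ)]

/-- Its π-twin `z_M^π := (π, πℓ₂, πℓ₃, πℓ_T)`. -/
noncomputable def zMpi : Fin 4 → ℂ :=
  ![(Real.pi : ℂ), (Real.pi : ℂ) * ((liouvilleNumber 2 : ℝ) : ℂ), (Real.pi : ℂ) * ((liouvilleNumber 3 : ℝ) : ℂ),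
    (Real.pi : ℂ) * ((ellT : ℝ) : ℂ)]

/-- An integer form in `z_M` is the real number `g₀ + g₁ℓ₂ + g₂ℓ₃ + g₃ℓ_T`. -/
theorem zM_form (g : Fin 4 → ℤ) :
    ∑ i, (g i : ℂ) * zM i =
      (((g 0 : ℝ) + g 1 * liouvilleNumber 2 + g 2 * liouvilleNumber 3 + g 3 * ellT : ℝ) : ℂ) := by
  simp only [Fin.sum_univ_four, zM, Matrix.cons_val_zero, Matrix.cons_val_one, Matrix.cons_val_two,
    Matrix.cons_val_three, Matrix.head_cons, Matrix.tail_cons]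
  push_cast; ring

/-- An integer form in `z_M^π` is `π · (g₀ + g₁ℓ₂ + g₂ℓ₃ + g₃ℓ_T)`. -/
theorem zMpi_form (g : Fin 4 → ℤ) :
    ∑ i, (g i : ℂ) * zMpi i =
      (Real.pi : ℂ) * (((g 0 : ℝ) + g 1 * liouvilleNumber 2 + g 2 * liouvilleNumber 3 + g 3 * ellT : ℝ) : ℂ) := by
  simp only [Fin.sum_univ_four, zMpi, Matrix.cons_val_zero, Matrix.cons_val_one, Matrix.cons_val_two,
    Matrix.cons_val_three, Matrix.head_cons, Matrix.tail_cons]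
  push_cast; ring

/-- The norm of an integer form in `z_M`. -/
theorem norm_zM_form (g : Fin 4 → ℤ) :
    ‖∑ i, (g i : ℂ) * zM i‖ = |(g 0 : ℝ) + g 1 * liouvilleNumber 2 + g 2 * liouvilleNumber 3 + g 3 * ellT| := by
  rw [zM_form, Complex.norm_real, Real.norm_eq_abs]

/-- The norm of an integer form in `z_M^π`. -/
theorem norm_zMpi_form (g : Fin 4 → ℤ) :
    ‖∑ i, (g i : ℂ) * zMpi i‖ =
      Real.pi * |(g 0 : ℝ) + g 1 * liouvilleNumber 2 + g 2 * liouvilleNumber 3 + g 3 * ellT| := by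
  rw [zMpi_form, norm_mul, Complex.norm_real, Complex.norm_real, Real.norm_eq_abs, Real.norm_eq_abs,
    abs_of_pos Real.pi_pos]

/-- No non-zero integer relation among `1, ℓ₂, ℓ₃, ℓ_T`. -/
theorem zM_form_ne_zero (g : Fin 4 → ℤ) (hg : g ≠ 0) :
    (g 0 : ℝ) + g 1 * liouvilleNumber 2 + g 2 * liouvilleNumber 3 + g 3 * ellT ≠ 0 := by
  intro h0
  have := form_lower_bound_M g hg
  rw [h0, abs_zero] at this
  exact absurd this (not_le.mpr (Real.exp_pos _))

/-- From integer to rational relations (clearing the common denominator), any length. -/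
private theorem linearIndependent_of_int_forms {N : ℕ} {z : Fin N → ℂ}
    (hz : ∀ g : Fin N → ℤ, g ≠ 0 → ∑ i, (g i : ℂ) * z i ≠ 0) : LinearIndependent ℚ z := by
  rw [Fintype.linearIndependent_iff]
  intro g hg
  by_contra hne
  obtain ⟨i₀, hi₀⟩ := not_forall.mp hne
  have hg' : ∑ i, ((g i : ℚ) : ℂ) * z i = 0 := by simpa [Rat.smul_def] using hg
  set D : ℕ := ∏ i, (g i).den with hD
  have hdvd : ∀ i, (g i).den ∣ D := fun i => Finset.dvd_prod_of_mem _ (Finset.mem_univ i)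
  have hDpos : 0 < D := Finset.prod_pos fun i _ => (g i).den_pos
  set G : Fin N → ℤ := fun i => (g i).num * ((D / (g i).den : ℕ) : ℤ) with hG
  have hGq : ∀ i, (G i : ℚ) = g i * D := by
    intro i
    obtain ⟨c, hc⟩ := hdvd i
    have e1 : D / (g i).den = c := by rw [hc, Nat.mul_div_cancel_left c (g i).den_pos]
    calc (G i : ℚ) = ((g i).num : ℚ) * (c : ℚ) := by rw [hG]; dsimp only; rw [e1]; push_cast; ring
      _ = g i * (g i).den * c := by rw [Rat.mul_den_eq_num]
      _ = g i * D := by rw [hc]; push_cast; ring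
  have hG0 : G ≠ 0 := by
    intro h0
    have h1 := congr_fun h0 i₀
    obtain ⟨c, hc⟩ := hdvd i₀
    have e1 : D / (g i₀).den = c := by rw [hc, Nat.mul_div_cancel_left c (g i₀).den_pos]
    have hc0 : c ≠ 0 := by
      rintro rfl
      rw [mul_zero] at hc
      omega
    rw [hG] at h1; dsimp only at h1; rw [e1] at h1
    exact mul_ne_zero (Rat.num_ne_zero.mpr hi₀) (by exact_mod_cast hc0) h1
  have hrel : ∑ i, (G i : ℂ) * z i = 0 := by
    have e : ∀ i, (G i : ℂ) = ((g i : ℚ) : ℂ) * (D : ℂ) := fun i => by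
      have h := congrArg (fun q : ℚ => (q : ℂ)) (hGq i)
      simpa using h
    calc ∑ i, (G i : ℂ) * z i = (D : ℂ) * ∑ i, ((g i : ℚ) : ℂ) * z i := by
          rw [Finset.mul_sum]
          exact Finset.sum_congr rfl fun i _ => by rw [e i]; ring
      _ = 0 := by rw [hg', mul_zero]
  exact hz G hG0 hrel

/-- **(i) `z_M` is ℚ-linearly independent** (hypothesis-free). -/
theorem linearIndependent_zM : LinearIndependent ℚ zM := by
  refine linearIndependent_of_int_forms fun g hg hrel => ?_
  have h := zM_form g
  rw [hrel] at h
  exact zM_form_ne_zero g hg (by exact_mod_cast h.symm)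

/-- **(i^π) `z_M^π` is ℚ-linearly independent** (hypothesis-free). -/
theorem linearIndependent_zMpi : LinearIndependent ℚ zMpi := by
  refine linearIndependent_of_int_forms fun g hg hrel => ?_
  have h := zMpi_form g
  rw [hrel] at h
  have hπ0 : (Real.pi : ℂ) ≠ 0 := by exact_mod_cast Real.pi_ne_zero
  have h' := (mul_eq_zero.mp h.symm).resolve_left hπ0
  exact zM_form_ne_zero g hg (by exact_mod_cast h')

/-- **(ii) `z_M` is Liouville to every polynomial order** (through its prefix `(1, ℓ₂)`; hypothesis-free). -/
theorem linLiouville_zM : LinLiouville zM := by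
  have hℓ : Liouville (liouvilleNumber 2) := by
    simpa using liouville_liouvilleNumber (le_refl 2)
  refine linLiouville_of_prefix (k := 2) (n := 4) (by norm_num) ?_
  have h2 : (fun i : Fin 2 => zM (Fin.castLE (show 2 ≤ 4 by norm_num) i)) =
      ![(1 : ℂ), ((liouvilleNumber 2 : ℝ) : ℂ) * 1] := by
    funext i; fin_cases i <;> simp [zM]
  rw [h2]
  exact linLiouville_of_liouville_ratio hℓ 1

/-- **(ii^π) `z_M^π` is Liouville to every polynomial order** (prefix `(π, πℓ₂)`; hypothesis-free). -/
theorem linLiouville_zMpi : LinLiouville zMpi := by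
  have hℓ : Liouville (liouvilleNumber 2) := by
    simpa using liouville_liouvilleNumber (le_refl 2)
  refine linLiouville_of_prefix (k := 2) (n := 4) (by norm_num) ?_
  have h2 : (fun i : Fin 2 => zMpi (Fin.castLE (show 2 ≤ 4 by norm_num) i)) =
      ![(Real.pi : ℂ), ((liouvilleNumber 2 : ℝ) : ℂ) * (Real.pi : ℂ)] := by
    funext i; fin_cases i <;> simp [zMpi, mul_comm]
  rw [h2]
  exact linLiouville_of_liouville_ratio hℓ (Real.pi : ℂ)

/-- **(iii) `z_M` has NO hyper-small integer forms** (the three-scale certificate; hypothesis-free). -/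
theorem not_hyperLinLiouville_zM : ¬ HyperLinLiouville zM := by
  intro hH
  obtain ⟨g, hg, hlt⟩ := hH 12
  rw [norm_zM_form] at hlt
  have hlow := form_lower_bound_M g hg
  have hX : (1 : ℝ) ≤ 1 + ∑ i, (|g i| : ℝ) := by
    have : (0 : ℝ) ≤ ∑ i, (|g i| : ℝ) :=
      Finset.sum_nonneg fun i _ => by exact_mod_cast abs_nonneg (g i)
    linarith
  have hmono : (1 + ∑ i, (|g i| : ℝ)) ^ 11 ≤ (1 + ∑ i, (|g i| : ℝ)) ^ 12 :=
    pow_le_pow_right₀ hX (by norm_num)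
  have := Real.exp_le_exp.mpr (neg_le_neg hmono)
  linarith

/-- **(iii^π) `z_M^π` has NO hyper-small integer forms** (`|π·form| ≥ |form|`; hypothesis-free). -/
theorem not_hyperLinLiouville_zMpi : ¬ HyperLinLiouville zMpi := by
  intro hH
  obtain ⟨g, hg, hlt⟩ := hH 12
  rw [norm_zMpi_form] at hlt
  have hlow := form_lower_bound_M g hg
  have hX : (1 : ℝ) ≤ 1 + ∑ i, (|g i| : ℝ) := by
    have : (0 : ℝ) ≤ ∑ i, (|g i| : ℝ) :=
      Finset.sum_nonneg fun i _ => by exact_mod_cast abs_nonneg (g i)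
    linarith
  have hmono : (1 + ∑ i, (|g i| : ℝ)) ^ 11 ≤ (1 + ∑ i, (|g i| : ℝ)) ^ 12 :=
    pow_le_pow_right₀ hX (by norm_num)
  have := Real.exp_le_exp.mpr (neg_le_neg hmono)
  have hπ : (1 : ℝ) ≤ Real.pi := by have := Real.pi_gt_three; linarith
  have habs := abs_nonneg ((g 0 : ℝ) + g 1 * liouvilleNumber 2 + g 2 * liouvilleNumber 3 + g 3 * ellT)
  nlinarith

/-- **(iv) Schanuel's bound AT `z_M`** (mod `hNW` only). -/
theorem sb_zM (hNW : NWMeasure) : SB 4 zM := sb_measuredWallCell hNW logHyperLiouville_ellT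

/-- **(iv^π) Schanuel's bound AT `z_M^π` — HYPOTHESIS-FREE.** -/
theorem sb_zMpi : SB 4 zMpi := sb_measuredWallCell_pi logHyperLiouville_ellT

/-- **`z_M` lies in the scope of item 33364** — all three hypotheses, hypothesis-free. -/
theorem zM_in_scope_33364 :
    LinearIndependent ℚ zM ∧
    (∀ ω : ℕ, ∃ h : Fin 4 → ℤ, h ≠ 0 ∧ ‖∑ i, (h i : ℂ) * zM i‖ < 1 / (1 + ∑ i, (|h i| : ℝ)) ^ ω) ∧
    (¬ ∀ m : ℕ, ∃ h : Fin 4 → ℤ, h ≠ 0 ∧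
      ‖∑ i, (h i : ℂ) * zM i‖ < Real.exp (-((1 + ∑ i, (|h i| : ℝ)) ^ m))) :=
  ⟨linearIndependent_zM, linLiouville_zM, not_hyperLinLiouville_zM⟩

/-- **`z_M^π` lies in the scope of item 33364** — all three hypotheses, hypothesis-free. -/
theorem zMpi_in_scope_33364 :
    LinearIndependent ℚ zMpi ∧
    (∀ ω : ℕ, ∃ h : Fin 4 → ℤ, h ≠ 0 ∧ ‖∑ i, (h i : ℂ) * zMpi i‖ < 1 / (1 + ∑ i, (|h i| : ℝ)) ^ ω) ∧
    (¬ ∀ m : ℕ, ∃ h : Fin 4 → ℤ, h ≠ 0 ∧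
      ‖∑ i, (h i : ℂ) * zMpi i‖ < Real.exp (-((1 + ∑ i, (|h i| : ℝ)) ^ m))) :=
  ⟨linearIndependent_zMpi, linLiouville_zMpi, not_hyperLinLiouville_zMpi⟩

/-- The member is IN the measured wall class (with `ρ = ℓ_T`). -/
theorem zM_inMeasuredWallClass : InMeasuredWallClass zM := ⟨ellT, logHyperLiouville_ellT, rfl⟩

/-- The π-twin member is IN the measured wall π-class. -/
theorem zMpi_inMeasuredWallClassPi : InMeasuredWallClassPi zMpi := ⟨ellT, logHyperLiouville_ellT, rfl⟩

/-- **ITEM 33364 DECIDED AT `z_M`** (mod `hNW`): scope (i)–(iii) hypothesis-free AND the conclusion. -/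
theorem finiteOrderLiouvilleSchanuel_at_zM (hNW : NWMeasure) :
    LinearIndependent ℚ zM ∧ LinLiouville zM ∧ ¬ HyperLinLiouville zM ∧ SB 4 zM :=
  ⟨linearIndependent_zM, linLiouville_zM, not_hyperLinLiouville_zM, sb_zM hNW⟩

/-- **ITEM 33364 DECIDED AT `z_M^π` — HYPOTHESIS-FREE**: scope (i)–(iii) AND the conclusion. -/
theorem finiteOrderLiouvilleSchanuel_at_zMpi :
    LinearIndependent ℚ zMpi ∧ LinLiouville zMpi ∧ ¬ HyperLinLiouville zMpi ∧ SB 4 zMpi :=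
  ⟨linearIndependent_zMpi, linLiouville_zMpi, not_hyperLinLiouville_zMpi, sb_zMpi⟩

/-! ### Separation: the member lies on no earlier cell of the lineage -/

/-- `ℓ_T` is none of the radix Liouville constants `ℓ_b` (`b ≥ 2`): `ℓ_T` is log-log-Liouville, `ℓ_b` is not. -/
theorem ellT_ne_liouvilleNumber {b : ℕ} (hb : 2 ≤ b) : ellT ≠ liouvilleNumber b := by
  intro h
  have h1 : LogLogLiouville ellT := logLogLiouville_of_logHyperLiouville logHyperLiouville_ellT
  rw [h] at h1
  exact not_logLogLiouville_liouvilleNumber hb h1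

/-- No `Fin 3`-indexed cell (the two-base, relative-Liouville, common-radix … cells of the lineage) has the
range of `z_M`: `z_M` is injective of length `4`. -/
theorem range_zM_ne_range_fin_three (w : Fin 3 → ℂ) : Set.range zM ≠ Set.range w := by
  intro h
  have hmem : ∀ i, ∃ j, w j = zM i := fun i => by
    have : zM i ∈ Set.range w := h ▸ Set.mem_range_self i
    exact this
  choose f hf using hmem
  have hinj : Function.Injective f := fun a b hab =>
    linearIndependent_zM.injective (by rw [← hf a, ← hf b, hab])
  have := Fintype.card_le_of_injective f hinj
  simp at this

/-- Likewise for the π-twin. -/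
theorem range_zMpi_ne_range_fin_three (w : Fin 3 → ℂ) : Set.range zMpi ≠ Set.range w := by
  intro h
  have hmem : ∀ i, ∃ j, w j = zMpi i := fun i => by
    have : zMpi i ∈ Set.range w := h ▸ Set.mem_range_self i
    exact this
  choose f hf using hmem
  have hinj : Function.Injective f := fun a b hab =>
    linearIndependent_zMpi.injective (by rw [← hf a, ← hf b, hab])
  have := Fintype.card_le_of_injective f hinj
  simp at this

/-- The last coordinate of `z_M` is on no radix block: `z_M 3 ≠ ℓ_b` for every `b ≥ 2` (so `z_M` is not a
`k`-instance `(1, ℓ_{b₁}, …, ℓ_{b_k})` of the two-base or multi-base cells). -/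
theorem zM_three_ne_liouvilleNumber {b : ℕ} (hb : 2 ≤ b) : zM 3 ≠ ((liouvilleNumber b : ℝ) : ℂ) := by
  intro h
  have h' : ((ellT : ℝ) : ℂ) = ((liouvilleNumber b : ℝ) : ℂ) := h
  exact ellT_ne_liouvilleNumber hb (by exact_mod_cast h')

/-- `z_M` lies on NO Liouville-block cell `Set.range z = Set.range (1, ℓ_{b_1}, …, ℓ_{b_k})` (`b_i ≥ 2`: the g36
two-base / multi-base cells, the g37 common-radix and block cells, all their `k`-instances): its last coordinate
`ℓ_T` is neither `1` nor any `ℓ_b`. Hypothesis-free. -/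
theorem zM_outside_liouvilleBlockCells :
    ¬ ∃ (k : ℕ) (b : Fin k → ℕ), (∀ i, 2 ≤ b i) ∧
      Set.range zM = Set.range (Fin.cons (1 : ℂ) (fun i => ((liouvilleNumber (b i) : ℝ) : ℂ))) := by
  rintro ⟨k, b, hb, hrange⟩
  have hmem : zM 3 ∈ Set.range (Fin.cons (1 : ℂ) (fun i => ((liouvilleNumber (b i) : ℝ) : ℂ)) :
      Fin (k + 1) → ℂ) := hrange ▸ Set.mem_range_self 3
  obtain ⟨j, hj⟩ := hmem
  have e3 : zM 3 = ((ellT : ℝ) : ℂ) := rfl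
  rw [e3] at hj
  revert hj
  refine Fin.cases ?_ (fun i => ?_) j <;> intro hj
  · simp only [Fin.cons_zero] at hj
    have h1 : ellT = 1 := by exact_mod_cast hj.symm
    have := ellT_lt_one
    linarith
  · simp only [Fin.cons_succ] at hj
    exact ellT_ne_liouvilleNumber (hb i) (by exact_mod_cast hj.symm)

/-- `z_M^π` lies on NO π-twin Liouville-block cell `Set.range z = Set.range (π, πℓ_{b_1}, …, πℓ_{b_k})` (`b_i ≥ 2`).
Hypothesis-free. -/
theorem zMpi_outside_liouvilleBlockCells :
    ¬ ∃ (k : ℕ) (b : Fin k → ℕ), (∀ i, 2 ≤ b i) ∧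
      Set.range zMpi = Set.range (Fin.cons (Real.pi : ℂ)
        (fun i => (Real.pi : ℂ) * ((liouvilleNumber (b i) : ℝ) : ℂ))) := by
  rintro ⟨k, b, hb, hrange⟩
  have hπ0 : (Real.pi : ℂ) ≠ 0 := by exact_mod_cast Real.pi_ne_zero
  have hmem : zMpi 3 ∈ Set.range (Fin.cons (Real.pi : ℂ)
      (fun i => (Real.pi : ℂ) * ((liouvilleNumber (b i) : ℝ) : ℂ)) : Fin (k + 1) → ℂ) :=
    hrange ▸ Set.mem_range_self 3
  obtain ⟨j, hj⟩ := hmem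
  have e3 : zMpi 3 = (Real.pi : ℂ) * ((ellT : ℝ) : ℂ) := rfl
  rw [e3] at hj
  revert hj
  refine Fin.cases ?_ (fun i => ?_) j <;> intro hj
  · simp only [Fin.cons_zero] at hj
    have h2 : (Real.pi : ℂ) * 1 = (Real.pi : ℂ) * ((ellT : ℝ) : ℂ) := by rw [mul_one]; exact hj
    have h1 : ellT = 1 := by exact_mod_cast ((mul_right_inj' hπ0).mp h2).symm
    have := ellT_lt_one
    linarith
  · simp only [Fin.cons_succ] at hj
    have h2 := (mul_right_inj' hπ0).mp hj
    exact ellT_ne_liouvilleNumber (hb i) (by exact_mod_cast h2.symm)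

/-- `z_M` lies on NO relative cell over `(1, ℓ₂)` — `Set.range z = Set.range (1, ℓ₂, ρ)`, `ρ` in ANY class (hyper-,
log-log-, log-hyper-, log-square-Liouville: g33–g35, lens 6) — nor on the two-base wall `(1, ℓ₂, ℓ₃)` (g36) or the
dependent-base wall `(1, ℓ₂, ℓ₄)` (g37): all are `Fin 3`-ranges. Hypothesis-free. -/
theorem zM_outside_fin_three_cells (P : ℝ → Prop) :
    (¬ ∃ ρ : ℝ, P ρ ∧ Set.range zM = Set.range ![(1 : ℂ), ((liouvilleNumber 2 : ℝ) : ℂ), (ρ : ℂ)]) ∧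
    Set.range zM ≠ Set.range ![(1 : ℂ), ((liouvilleNumber 2 : ℝ) : ℂ), ((liouvilleNumber 3 : ℝ) : ℂ)] ∧
    Set.range zM ≠ Set.range ![(1 : ℂ), ((liouvilleNumber 2 : ℝ) : ℂ), ((liouvilleNumber 4 : ℝ) : ℂ)] :=
  ⟨fun ⟨_, _, h⟩ => range_zM_ne_range_fin_three _ h, range_zM_ne_range_fin_three _,
    range_zM_ne_range_fin_three _⟩

/-- The π-twin analogue. -/
theorem zMpi_outside_fin_three_cells (P : ℝ → Prop) :
    (¬ ∃ ρ : ℝ, P ρ ∧ Set.range zMpi =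
      Set.range ![(Real.pi : ℂ), (Real.pi : ℂ) * ((liouvilleNumber 2 : ℝ) : ℂ), (Real.pi : ℂ) * (ρ : ℂ)]) ∧
    Set.range zMpi ≠ Set.range ![(Real.pi : ℂ), (Real.pi : ℂ) * ((liouvilleNumber 2 : ℝ) : ℂ),
      (Real.pi : ℂ) * ((liouvilleNumber 3 : ℝ) : ℂ)] :=
  ⟨fun ⟨_, _, h⟩ => range_zMpi_ne_range_fin_three _ h, range_zMpi_ne_range_fin_three _⟩

end Member

end Summit.Schanuel.Schanuel.Theorems.RootDecomp1KMeasuredWallCell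

end
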